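import Mathlib
import Summits.Ventures.PercRepro2.TypedMaskGraphs

/-!
# The instance pieces (blind cell PercRepro2, p2 g3, 2026-08-25): the pieces of the star sum that
are typed counts of smaller instances

On any base `B`, `pN = N(B)`, `pE (pair) = N(B + e(1))`, `pE2 (pair) = N(B + e(2))` and
`pC (e₁₃, e₂₃) + pE (tri) = N(B + e₁₃(1) + e₂₃(1))` — typed counts of instances with one or two
virtual edges re-attached to the neighbours (`pN_eq`, `pE_eq_typedCount`, `pE2_eq_typedCount`,
`pC_pT1_eq_typedCount`). So in the pieces identities of TypedMaskPieces only `pE (tri)`,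
`pE2 (tri)`, `pM` and `pB + pM` are genuinely hyper-objects: the hyperstar Props.
-/

namespace Summit.Ventures.PercRepro2

namespace CovForm

namespace TypedRed

namespace Mask

open TwoTerm OneTyped

/-! ## The single-copy states of the virtual edges -/

section States

open Classical

variable {V : Type*} [DecidableEq V] {E : Type*} [DecidableEq E]

/-- The state of a copy with the virtual edge `e ↦ s(v, w)` open: the pair mask. -/
lemma st_virtual_true (ends : E → Sym2 V) (o a₁ a₂ a₃ b : V) {e : E} (v w : V) {x : Config E}
    (hx : x e = false) :
    st (Function.update ends e s(v, w)) o a₁ a₂ a₃ b (Function.update x e true) =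
      stG o a₁ a₂ a₃ b (openGraph ends x ⊔ SimpleGraph.fromRel (relOf (cliq {v, w}))) := by
  rw [st_eq_stG, openGraph_update_true _ _ (Function.update_self e s(v, w) ends),
    openGraph_update_ends_closed ends hx, fromRel_relOf_cliq_pair]

omit [DecidableEq V] in
/-- The state of a copy with the virtual edge closed: no mask. -/
lemma st_virtual_false (ends : E → Sym2 V) (o a₁ a₂ a₃ b : V) {e : E} (s : Sym2 V) {x : Config E}
    (hx : x e = false) :
    st (Function.update ends e s) o a₁ a₂ a₃ b (Function.update x e false) =
      stG o a₁ a₂ a₃ b (openGraph ends x ⊔ SimpleGraph.fromRel (relOf (∅ : Finset (V × V)))) := by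
  rw [st_eq_stG, update_false_eq hx, openGraph_update_ends_closed ends hx, fromRel_relOf_empty,
    sup_bot_eq]

/-- The mask of a copy carrying two virtual edges `v₁–v₃`, `v₂–v₃` in the states `p, q`. -/
def twoMask (v₁ v₂ v₃ : V) (p q : Bool) : Finset (V × V) :=
  if p then (if q then cliq {v₁, v₂, v₃} else cliq {v₁, v₃}) else (if q then cliq {v₂, v₃} else ∅)

/-- The state of a copy carrying the two virtual edges. -/
lemma st_virtual_two (ends : E → Sym2 V) (o a₁ a₂ a₃ b : V) {e e' : E} (hee : e ≠ e')
    (v₁ v₂ v₃ : V) {x : Config E} (hx : x e = false) (hx' : x e' = false) (p q : Bool) :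
    st (Function.update (Function.update ends e s(v₁, v₃)) e' s(v₂, v₃)) o a₁ a₂ a₃ b
        (Function.update (Function.update x e p) e' q) =
      stG o a₁ a₂ a₃ b (openGraph ends x ⊔ SimpleGraph.fromRel (relOf (twoMask v₁ v₂ v₃ p q))) := by
  set ends'' := Function.update (Function.update ends e s(v₁, v₃)) e' s(v₂, v₃) with hends''
  have he'' : ends'' e' = s(v₂, v₃) := by rw [hends'', Function.update_self]
  have he : ends'' e = s(v₁, v₃) := by rw [hends'', Function.update_of_ne hee, Function.update_self]
  have hxe : Function.update x e p e' = false := by rw [Function.update_of_ne hee.symm]; exact hx'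
  rw [st_eq_stG]
  cases q
  · rw [update_false_eq hxe]
    cases p
    · rw [update_false_eq hx, hends'', openGraph_update_ends_closed _ hx',
        openGraph_update_ends_closed ends hx]
      simp only [twoMask, Bool.false_eq_true, if_false, fromRel_relOf_empty, sup_bot_eq]
    · rw [openGraph_update_true _ _ he, hends'', openGraph_update_ends_closed _ hx',
        openGraph_update_ends_closed ends hx]
      simp only [twoMask, if_true, Bool.false_eq_true, if_false, fromRel_relOf_cliq_pair]
  · rw [openGraph_update_true _ _ he'']
    cases p
    · rw [update_false_eq hx, hends'', openGraph_update_ends_closed _ hx',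
        openGraph_update_ends_closed ends hx]
      simp only [twoMask, Bool.false_eq_true, if_false, if_true, fromRel_relOf_cliq_pair]
    · rw [openGraph_update_true _ _ he, hends'', openGraph_update_ends_closed _ hx',
        openGraph_update_ends_closed ends hx]
      simp only [twoMask, if_true]
      exact stG_congr_reachable o a₁ a₂ a₃ b (reachable_path_iff_tri _ v₁ v₂ v₃)

end States

/-! ## The instance pieces -/

section Inst

open Classical

variable {V : Type*} [DecidableEq V] {E : Type*} [Fintype E] [DecidableEq E] {R : Type*} [Field R]

omit [DecidableEq V] in
/-- `pN` is the typed base of the base. -/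
lemma pN_eq (F : Finset E) (z : Config E) (τ : E → ℕ) (ends : E → Sym2 V) (o a₁ a₂ a₃ b : V) :
    (pN F z τ ends o a₁ a₂ a₃ b : R) =
      typedCount F z τ (K3 ends o a₁ a₂ a₃ b : Config E → Config E → Config E → R) := by
  unfold pN maskCount
  refine typedCount_congr_K_on _ _ _ fun x y w _ _ => ?_
  rw [K3_eq_KB, st_eq_stG, st_eq_stG, st_eq_stG]
  simp only [fromRel_relOf_empty, sup_bot_eq]

/-- The three single-placement sums of a one-copy object. -/
lemma sum_bool3_one (T : Bool → Bool → Bool → R) :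
    (∑ a : Bool, ∑ b : Bool, ∑ c : Bool,
        if a.toNat + b.toNat + c.toNat = 1 then T a b c else 0) =
      T true false false + T false true false + T false false true := by
  simp only [Fintype.sum_bool, Bool.toNat_true, Bool.toNat_false, Nat.reduceEqDiff, if_true,
    if_false, add_zero, zero_add]
  ring

/-- The three single-placement sums of a two-copy object. -/
lemma sum_bool3_two (T : Bool → Bool → Bool → R) :
    (∑ a : Bool, ∑ b : Bool, ∑ c : Bool,
        if a.toNat + b.toNat + c.toNat = 2 then T a b c else 0) =
      T true true false + T true false true + T false true true := by
  simp only [Fintype.sum_bool, Bool.toNat_true, Bool.toNat_false, Nat.reduceEqDiff, if_true,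
    if_false, add_zero, zero_add]

/-- **`pE (pair) = N(B + e(1))`**: the object `v–w` in one copy is a virtual typed edge of type 1. -/
lemma pE_eq_typedCount (F : Finset E) (z : Config E) (τ : E → ℕ) (ends : E → Sym2 V)
    (o a₁ a₂ a₃ b : V) {e : E} (he : e ∉ F) (hz : z e = false) (v w : V) :
    (pE F z τ ends o a₁ a₂ a₃ b (cliq {v, w}) : R) =
      typedCount (insert e F) z (Function.update τ e 1)
        (K3 (Function.update ends e s(v, w)) o a₁ a₂ a₃ b) := by
  rw [typedCount_split (insert e F) e (Finset.mem_insert_self _ _), Function.update_self,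
    Finset.erase_insert he, update_false_eq hz]
  have hτ : ∀ e' ∈ F, Function.update τ e 1 e' = τ e' := fun e' he' =>
    Function.update_of_ne (fun h => he (by rw [← h]; exact he')) _ _
  -- the single-copy kernel
  have hker : ∀ (p : Bool) (x : Config E), x e = false →
      st (Function.update ends e s(v, w)) o a₁ a₂ a₃ b (Function.update x e p) =
        stG o a₁ a₂ a₃ b (openGraph ends x ⊔
          SimpleGraph.fromRel (relOf (if p then cliq {v, w} else ∅))) := by
    intro p x hx
    cases p
    · simp only [Bool.false_eq_true, if_false]; exact st_virtual_false ends o a₁ a₂ a₃ b _ hx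
    · simp only [if_true]; exact st_virtual_true ends o a₁ a₂ a₃ b v w hx
  have hterm : ∀ p q r : Bool, typedCount F z (Function.update τ e 1) (fun x y w' =>
      K3 (Function.update ends e s(v, w)) o a₁ a₂ a₃ b (Function.update x e p)
        (Function.update y e q) (Function.update w' e r)) =
      (maskCount F z τ ends o a₁ a₂ a₃ b (if p then cliq {v, w} else ∅)
        (if q then cliq {v, w} else ∅) (if r then cliq {v, w} else ∅) : R) := by
    intro p q r
    unfold maskCount
    rw [typedCount_congr_τ F z hτ]
    refine typedCount_congr_K_on _ _ _ fun x y w' hxyw _ => ?_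
    have hx : x e = false := by rw [(hxyw e he).1, hz]
    have hy : y e = false := by rw [(hxyw e he).2.1, hz]
    have hw : w' e = false := by rw [(hxyw e he).2.2, hz]
    rw [K3_eq_KB, hker p x hx, hker q y hy, hker r w' hw]
  simp only [hterm]
  rw [sum_bool3_one (fun p q r => (maskCount F z τ ends o a₁ a₂ a₃ b (if p then cliq {v, w} else ∅)
    (if q then cliq {v, w} else ∅) (if r then cliq {v, w} else ∅) : R))]
  simp only [if_true, Bool.false_eq_true, if_false]
  unfold pE
  ring

/-- **`pE2 (pair) = N(B + e(2))`**: the object `v–w` in two copies is a virtual typed edge of type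
2. -/
lemma pE2_eq_typedCount (F : Finset E) (z : Config E) (τ : E → ℕ) (ends : E → Sym2 V)
    (o a₁ a₂ a₃ b : V) {e : E} (he : e ∉ F) (hz : z e = false) (v w : V) :
    (pE2 F z τ ends o a₁ a₂ a₃ b (cliq {v, w}) : R) =
      typedCount (insert e F) z (Function.update τ e 2)
        (K3 (Function.update ends e s(v, w)) o a₁ a₂ a₃ b) := by
  rw [typedCount_split (insert e F) e (Finset.mem_insert_self _ _), Function.update_self,
    Finset.erase_insert he, update_false_eq hz]
  have hτ : ∀ e' ∈ F, Function.update τ e 2 e' = τ e' := fun e' he' =>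
    Function.update_of_ne (fun h => he (by rw [← h]; exact he')) _ _
  have hker : ∀ (p : Bool) (x : Config E), x e = false →
      st (Function.update ends e s(v, w)) o a₁ a₂ a₃ b (Function.update x e p) =
        stG o a₁ a₂ a₃ b (openGraph ends x ⊔
          SimpleGraph.fromRel (relOf (if p then cliq {v, w} else ∅))) := by
    intro p x hx
    cases p
    · simp only [Bool.false_eq_true, if_false]; exact st_virtual_false ends o a₁ a₂ a₃ b _ hx
    · simp only [if_true]; exact st_virtual_true ends o a₁ a₂ a₃ b v w hx
  have hterm : ∀ p q r : Bool, typedCount F z (Function.update τ e 2) (fun x y w' =>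
      K3 (Function.update ends e s(v, w)) o a₁ a₂ a₃ b (Function.update x e p)
        (Function.update y e q) (Function.update w' e r)) =
      (maskCount F z τ ends o a₁ a₂ a₃ b (if p then cliq {v, w} else ∅)
        (if q then cliq {v, w} else ∅) (if r then cliq {v, w} else ∅) : R) := by
    intro p q r
    unfold maskCount
    rw [typedCount_congr_τ F z hτ]
    refine typedCount_congr_K_on _ _ _ fun x y w' hxyw _ => ?_
    have hx : x e = false := by rw [(hxyw e he).1, hz]
    have hy : y e = false := by rw [(hxyw e he).2.1, hz]
    have hw : w' e = false := by rw [(hxyw e he).2.2, hz]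
    rw [K3_eq_KB, hker p x hx, hker q y hy, hker r w' hw]
  simp only [hterm]
  rw [sum_bool3_two (fun p q r => (maskCount F z τ ends o a₁ a₂ a₃ b (if p then cliq {v, w} else ∅)
    (if q then cliq {v, w} else ∅) (if r then cliq {v, w} else ∅) : R))]
  simp only [if_true, Bool.false_eq_true, if_false]
  unfold pE2
  ring

/-- **`pC (e₁₃, e₂₃) + pE (tri) = N(B + e₁₃(1) + e₂₃(1))`**: two one-copy objects sharing a vertex
are two virtual typed edges of type 1 (in the same copy they see the triangle). -/
lemma pC_pT1_eq_typedCount (F : Finset E) (z : Config E) (τ : E → ℕ) (ends : E → Sym2 V)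
    (o a₁ a₂ a₃ b : V) {e e' : E} (he : e ∉ F) (he' : e' ∉ F) (hee : e ≠ e') (hz : z e = false)
    (hz' : z e' = false) (v₁ v₂ v₃ : V) :
    (pC F z τ ends o a₁ a₂ a₃ b (cliq {v₁, v₃}) (cliq {v₂, v₃}) +
        pE F z τ ends o a₁ a₂ a₃ b (cliq {v₁, v₂, v₃}) : R) =
      typedCount (insert e' (insert e F)) z (Function.update (Function.update τ e 1) e' 1)
        (K3 (Function.update (Function.update ends e s(v₁, v₃)) e' s(v₂, v₃)) o a₁ a₂ a₃ b) := by
  have he'' : e' ∉ insert e F := by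
    rw [Finset.mem_insert, not_or]; exact ⟨Ne.symm hee, he'⟩
  rw [typedCount_split (insert e' (insert e F)) e' (Finset.mem_insert_self _ _),
    Function.update_self, Finset.erase_insert he'', update_false_eq hz']
  simp only [typedCount_split (insert e F) e (Finset.mem_insert_self _ _),
    Function.update_of_ne hee, Function.update_self, Finset.erase_insert he, update_false_eq hz]
  have hτ : ∀ e'' ∈ F, Function.update (Function.update τ e 1) e' 1 e'' = τ e'' := fun e'' h => by
    rw [Function.update_of_ne (fun h' => he' (by rw [← h']; exact h)),
      Function.update_of_ne (fun h' => he (by rw [← h']; exact h))]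
  have hterm : ∀ q₁ q₂ q₃ p₁ p₂ p₃ : Bool,
      typedCount F z (Function.update (Function.update τ e 1) e' 1) (fun x y w =>
        K3 (Function.update (Function.update ends e s(v₁, v₃)) e' s(v₂, v₃)) o a₁ a₂ a₃ b
          (Function.update (Function.update x e p₁) e' q₁)
          (Function.update (Function.update y e p₂) e' q₂)
          (Function.update (Function.update w e p₃) e' q₃)) =
      (maskCount F z τ ends o a₁ a₂ a₃ b (twoMask v₁ v₂ v₃ p₁ q₁) (twoMask v₁ v₂ v₃ p₂ q₂)
        (twoMask v₁ v₂ v₃ p₃ q₃) : R) := by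
    intro q₁ q₂ q₃ p₁ p₂ p₃
    unfold maskCount
    rw [typedCount_congr_τ F z hτ]
    refine typedCount_congr_K_on _ _ _ fun x y w hxyw _ => ?_
    have hx : x e = false := by rw [(hxyw e he).1, hz]
    have hy : y e = false := by rw [(hxyw e he).2.1, hz]
    have hw : w e = false := by rw [(hxyw e he).2.2, hz]
    have hx' : x e' = false := by rw [(hxyw e' he').1, hz']
    have hy' : y e' = false := by rw [(hxyw e' he').2.1, hz']
    have hw' : w e' = false := by rw [(hxyw e' he').2.2, hz']
    rw [K3_eq_KB, st_virtual_two ends o a₁ a₂ a₃ b hee v₁ v₂ v₃ hx hx',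
      st_virtual_two ends o a₁ a₂ a₃ b hee v₁ v₂ v₃ hy hy',
      st_virtual_two ends o a₁ a₂ a₃ b hee v₁ v₂ v₃ hw hw']
  simp only [hterm]
  simp only [Fintype.sum_bool, Bool.toNat_true, Bool.toNat_false, Nat.reduceEqDiff, if_true,
    if_false, add_zero, zero_add, twoMask, Bool.false_eq_true]
  unfold pC pE
  ring

end Inst

end Mask

end TypedRed

end CovForm

end Summit.Ventures.PercRepro2
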